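import Mathlib
import Summits.KontsevichZagierPeriods.KontsevichZagierPeriods.Theorems.SoloInformedZetaTwoTwoGarland
import Summits.KontsevichZagierPeriods.KontsevichZagierPeriods.Theorems.SoloInformedZetaFourSum
import HarnessLib
import HarnessLib.Audit

/-!
# SoloInformed — the `(2,2)` telescope: star side and the relation `4·[Z(3,1)] = [Z(4)]` in `𝒫`

Solo programme `solo-KontsevichZagierPeriods-informed`, session s45 (PART XVI).

* Garland side: the five pieces of `SoloInformedZetaTwoTwoGarland` are coordinate permutations of
  Kontsevich's simplex representations: `[P₀] ≡ [Z(2,2)]`, `[P_k] ≡ [Z(3,1)]` (`k = 1..4`); hence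
  `[R₁] ≡ [Z(2,2)] + 4[Z(3,1)]`.
* Star side: `S = q + p₂` with `q = x₀x₁/((1−x₀x₁)(1−x₀x₁x₂x₃))`, `p₂ = 1/(1−x₀x₁x₂x₃)` (rule (1b)),
  and the iterated substitution `κ` carries `q ↦ Z(2,2)`, `p₂ ↦ Z(4)` (rule (2)); hence
  `[R₂] ≡ [Z(2,2)] + [Z(4)]` (Kaneko–Yamamoto: `ζ⋆(2,2) = ζ(2,2) + ζ(4)`).
* With the step `[R₁] ≡ [R₂]`: **`4·[Z(3,1)] − [Z(4)] ∈ KZ.relations`**, i.e.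
  `4·mzvClass [3,1] = mzvClass [4]` in `𝒫` — the weight-4 finite-double-shuffle relation, obtained by
  telescope moves alone. Together with `SoloInformedZetaFourSum` (`[3,1] + [2,2] = [4]`) and
  `SoloInformedZetaFourDual` (`[2,1,1] = [4]`): the weight-4 MZV sector of `𝒫` is cyclic, generated by
  `mzvClass [3,1]` (`soloInformed_mzvClass_weight4_cyclic`).
-/

noncomputable section

open MeasureTheory Set MvPolynomial
open Literature.ModelTheory.ExponentialFields Literature.NumberTheory.Transcendental
open Literature.NumberTheory.Transcendental.KZ

namespace Summit.KontsevichZagierPeriods.KontsevichZagierPeriods.Theorems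

/-! ## 1. Pieces are permuted simplex representations -/

/-- A reindexing followed by an equality of representations is a relation. -/
theorem soloInformed_sub_of_reindex_eqOn {P R : IntegralRep 4} (e : Fin 4 ≃ Fin 4)
    (hdom : R.domain = (P.reindex e).domain)
    (hint : EqOn (P.reindex e).integrand R.integrand (P.reindex e).domain) :
    of P - of R ∈ relations := by
  have h1 := of_sub_of_reindex_mem_relations P e
  have h2 : of (P.reindex e) - of R ∈ relations := of_sub_of_mem_relations_of_eqOn hdom hint
  have h : of P - of R = (of P - of (P.reindex e)) + (of (P.reindex e) - of R) := by abel
  rw [h]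
  exact relations.add_mem h1 h2

/-- The sorting permutations of the four `Z(3,1)`-chains. -/
def soloInformedT22E1 : Fin 4 ≃ Fin 4 := ⟨![0, 2, 1, 3], ![0, 2, 1, 3], by decide, by decide⟩
/-- Auxiliary. -/
def soloInformedT22E2 : Fin 4 ≃ Fin 4 := ⟨![0, 3, 1, 2], ![0, 2, 3, 1], by decide, by decide⟩
/-- Auxiliary. -/
def soloInformedT22E3 : Fin 4 ≃ Fin 4 := ⟨![1, 2, 0, 3], ![2, 0, 1, 3], by decide, by decide⟩
/-- Auxiliary. -/
def soloInformedT22E4 : Fin 4 ≃ Fin 4 := ⟨![1, 3, 0, 2], ![2, 0, 3, 1], by decide, by decide⟩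

/-- Values of the permutations. -/
theorem soloInformedT22E_apply :
    (soloInformedT22E1 0 = 0 ∧ soloInformedT22E1 1 = 2 ∧ soloInformedT22E1 2 = 1 ∧ soloInformedT22E1 3 = 3)
    ∧ (soloInformedT22E2 0 = 0 ∧ soloInformedT22E2 1 = 3 ∧ soloInformedT22E2 2 = 1 ∧ soloInformedT22E2 3 = 2)
    ∧ (soloInformedT22E3 0 = 1 ∧ soloInformedT22E3 1 = 2 ∧ soloInformedT22E3 2 = 0 ∧ soloInformedT22E3 3 = 3)
    ∧ (soloInformedT22E4 0 = 1 ∧ soloInformedT22E4 1 = 3 ∧ soloInformedT22E4 2 = 0 ∧ soloInformedT22E4 3 = 2) :=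
  ⟨⟨rfl, rfl, rfl, rfl⟩, ⟨rfl, rfl, rfl, rfl⟩, ⟨rfl, rfl, rfl, rfl⟩, ⟨rfl, rfl, rfl, rfl⟩⟩

/-- The integrand identity `g'(sorted) = Z(3,1)`-integrand, in the four arrangements. -/
theorem soloInformedT22g_perm (w : Fin 4 → ℝ) :
    1 / (w 0 * (1 - w 2) * w 1 * (1 - w 3)) = soloInformedZ31.integrand w ∧
    1 / (w 0 * (1 - w 3) * w 1 * (1 - w 2)) = soloInformedZ31.integrand w ∧
    1 / (w 1 * (1 - w 2) * w 0 * (1 - w 3)) = soloInformedZ31.integrand w ∧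
    1 / (w 1 * (1 - w 3) * w 0 * (1 - w 2)) = soloInformedZ31.integrand w := by
  rw [soloInformedZ31_integrand, one_div_mul_one_div, one_div_mul_one_div, one_div_mul_one_div]
  refine ⟨?_, ?_, ?_, ?_⟩ <;> (congr 1; ring)

/-- `[P₀] − [Z(2,2)] ∈ relations` (the chain `t₀>t₁>t₂>t₃` is the simplex itself). -/
theorem soloInformed_t22P0_sub : of soloInformedT22P0 - of soloInformedZ22 ∈ relations :=
  of_sub_of_mem_relations_of_eqOn
    (by rw [soloInformedZ22_domain, soloInformedT22P0_domain, soloInformed_ch4_0123]) fun w _ => by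
      rw [soloInformedT22P0_integrand, soloInformedT22g, soloInformedZ22_integrand, one_div_mul_one_div,
        one_div_mul_one_div, one_div_mul_one_div]

/-- `[P₁] − [Z(3,1)] ∈ relations`. -/
theorem soloInformed_t22P1_sub : of soloInformedT22P1 - of soloInformedZ31 ∈ relations := by
  obtain ⟨⟨e0, e1, e2, e3⟩, -, -, -⟩ := soloInformedT22E_apply
  refine soloInformed_sub_of_reindex_eqOn soloInformedT22E1 ?_ fun w _ => ?_
  · rw [IntegralRep.reindex_domain, soloInformedT22P1_domain, soloInformedZ31_domain,
      soloInformed_openOrderedSimplex4_eq]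
    ext w
    simp only [mem_setOf_eq, soloInformed_mem_ch4, soloInformed_mem_nabla4,
      soloInformed_comp_mem_openCube_iff, e0, e1, e2, e3]
  · simp only [IntegralRep.reindex_integrand, soloInformedT22P1_integrand, soloInformedT22g, e0, e1,
      e2, e3]
    exact (soloInformedT22g_perm w).1

/-- `[P₂] − [Z(3,1)] ∈ relations`. -/
theorem soloInformed_t22P2_sub : of soloInformedT22P2 - of soloInformedZ31 ∈ relations := by
  obtain ⟨-, ⟨e0, e1, e2, e3⟩, -, -⟩ := soloInformedT22E_apply
  refine soloInformed_sub_of_reindex_eqOn soloInformedT22E2 ?_ fun w _ => ?_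
  · rw [IntegralRep.reindex_domain, soloInformedT22P2_domain, soloInformedZ31_domain,
      soloInformed_openOrderedSimplex4_eq]
    ext w
    simp only [mem_setOf_eq, soloInformed_mem_ch4, soloInformed_mem_nabla4,
      soloInformed_comp_mem_openCube_iff, e0, e1, e2, e3]
  · simp only [IntegralRep.reindex_integrand, soloInformedT22P2_integrand, soloInformedT22g, e0, e1,
      e2, e3]
    exact (soloInformedT22g_perm w).2.1

/-- `[P₃] − [Z(3,1)] ∈ relations`. -/
theorem soloInformed_t22P3_sub : of soloInformedT22P3 - of soloInformedZ31 ∈ relations := by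
  obtain ⟨-, -, ⟨e0, e1, e2, e3⟩, -⟩ := soloInformedT22E_apply
  refine soloInformed_sub_of_reindex_eqOn soloInformedT22E3 ?_ fun w _ => ?_
  · rw [IntegralRep.reindex_domain, soloInformedT22P3_domain, soloInformedZ31_domain,
      soloInformed_openOrderedSimplex4_eq]
    ext w
    simp only [mem_setOf_eq, soloInformed_mem_ch4, soloInformed_mem_nabla4,
      soloInformed_comp_mem_openCube_iff, e0, e1, e2, e3]
  · simp only [IntegralRep.reindex_integrand, soloInformedT22P3_integrand, soloInformedT22g, e0, e1,
      e2, e3]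
    exact (soloInformedT22g_perm w).2.2.1

/-- `[P₄] − [Z(3,1)] ∈ relations`. -/
theorem soloInformed_t22P4_sub : of soloInformedT22P4 - of soloInformedZ31 ∈ relations := by
  obtain ⟨-, -, -, ⟨e0, e1, e2, e3⟩⟩ := soloInformedT22E_apply
  refine soloInformed_sub_of_reindex_eqOn soloInformedT22E4 ?_ fun w _ => ?_
  · rw [IntegralRep.reindex_domain, soloInformedT22P4_domain, soloInformedZ31_domain,
      soloInformed_openOrderedSimplex4_eq]
    ext w
    simp only [mem_setOf_eq, soloInformed_mem_ch4, soloInformed_mem_nabla4,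
      soloInformed_comp_mem_openCube_iff, e0, e1, e2, e3]
  · simp only [IntegralRep.reindex_integrand, soloInformedT22P4_integrand, soloInformedT22g, e0, e1,
      e2, e3]
    exact (soloInformedT22g_perm w).2.2.2

/-- **The garland side assembled**: `[R₁] − ([Z(2,2)] + 4·[Z(3,1)]) ∈ relations`
(Yamamoto: `ζ⋆(2,2) = ζ(2,2) + 4ζ(3,1)` as a sum over the five linear extensions, inside the rules). -/
theorem soloInformed_t22_R1_sub :
    of soloInformedT22Datum.R1 - (of soloInformedZ22 + 4 • of soloInformedZ31) ∈ relations := by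
  have h : of soloInformedT22Datum.R1 - (of soloInformedZ22 + 4 • of soloInformedZ31)
      = (of soloInformedT22Datum.R1 - of soloInformedT22GRep)
        + (of soloInformedT22GRep - (of soloInformedT22P0 + of soloInformedT22P1 + of soloInformedT22P2
            + of soloInformedT22P3 + of soloInformedT22P4))
        + (of soloInformedT22P0 - of soloInformedZ22) + (of soloInformedT22P1 - of soloInformedZ31)
        + (of soloInformedT22P2 - of soloInformedZ31) + (of soloInformedT22P3 - of soloInformedZ31)
        + (of soloInformedT22P4 - of soloInformedZ31) := by abel
  rw [h]
  exact relations.add_mem (relations.add_mem (relations.add_mem (relations.add_mem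
    (relations.add_mem (relations.add_mem soloInformed_t22_moveA soloInformed_t22_moveB)
    soloInformed_t22P0_sub) soloInformed_t22P1_sub) soloInformed_t22P2_sub) soloInformed_t22P3_sub)
    soloInformed_t22P4_sub

/-! ## 2. The star side: `S = q + p₂`, `q ↦ Z(2,2)`, `p₂ ↦ Z(4)` along `κ` -/

/-- `q(x) = x₀x₁/((1 − x₀x₁)(1 − x₀x₁x₂x₃))` (in the factor order of the datum). -/
def soloInformedT22q (x : Fin 4 → ℝ) : ℝ :=
  x 1 * x 0 / ((1 - x 1 * x 0) * (1 - x 1 * x 0 * (x 2 * x 3)))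

section bounds
variable {x : Fin 4 → ℝ}

/-- `S = q + p₂` on the cube. -/
theorem soloInformed_T22FS_eq_q_add_p2 (hx : x ∈ soloInformedOpenCube 4) :
    soloInformedT22Datum.R2.integrand x = soloInformedT22q x + soloInformedZ4p2 x := by
  rw [soloInformedT22_R2_integrand, soloInformedT22q, soloInformedZ4p2,
    show (1 - x 1 * x 2 * x 0 * x 3) = (1 - x 1 * x 0 * (x 2 * x 3)) by ring]
  set a := 1 - x 1 * x 0 with ha_def
  set b := 1 - x 1 * x 0 * (x 2 * x 3) with hb_def
  have ha : a ≠ 0 := (soloInformed_T22_pos1 hx).ne'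
  have hb : b ≠ 0 := (soloInformed_T22_pos3 hx).ne'
  field_simp
  rw [ha_def]; ring

/-- `0 ≤ q ≤ S`. -/
theorem soloInformedT22q_bounds (hx : x ∈ soloInformedOpenCube 4) :
    0 ≤ soloInformedT22q x ∧ soloInformedT22q x ≤ soloInformedT22Datum.R2.integrand x := by
  have ha := soloInformed_T22_pos1 hx
  have hb := soloInformed_T22_pos3 hx
  have hp : 0 < x 1 * x 0 := mul_pos (hx 1).1 (hx 0).1
  rw [soloInformedT22_R2_integrand, soloInformedT22q]
  exact ⟨div_nonneg hp.le (mul_pos ha hb).le,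
    div_le_div_of_nonneg_right (by linarith) (mul_pos ha hb).le⟩

/-- The pull-back identity `q(x) = Z(2,2)(κ x) · |det J_κ(x)|`. -/
theorem soloInformedT22q_kappa (hx : x ∈ soloInformedOpenCube 4) :
    soloInformedT22q x = soloInformedZ22.integrand (soloInformedKappaMap 4 x) *
      |(soloInformedJacCLM (soloInformedMonoPoly 4) x).det| := by
  obtain ⟨k0, k1, k2, k3⟩ := soloInformed_kappa4_apply x
  have h0 := hx 0; have h1 := hx 1; have h2 := hx 2
  rw [soloInformedZ22_integrand, k0, k1, k2, k3, soloInformed_kappa4_det,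
    abs_of_pos (by have := h0.1; have := h1.1; have := h2.1; positivity :
      0 < x 0 * x 0 * x 0 * x 1 * x 1 * x 2), soloInformedT22q]
  set a := 1 - x 1 * x 0 with ha_def
  set b := 1 - x 1 * x 0 * (x 2 * x 3) with hb_def
  have ha : a ≠ 0 := (soloInformed_T22_pos1 hx).ne'
  have hb : b ≠ 0 := (soloInformed_T22_pos3 hx).ne'
  have hy : x 0 ≠ 0 := h0.1.ne'
  have hu : x 1 ≠ 0 := h1.1.ne'
  have hv : x 2 ≠ 0 := h2.1.ne'
  rw [show 1 - x 0 * x 1 = a by rw [ha_def]; ring,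
    show 1 - x 0 * x 1 * x 2 * x 3 = b by rw [hb_def]; ring]
  field_simp

/-- Continuity of `q` on the cube. -/
theorem soloInformed_continuousOn_T22q : ContinuousOn soloInformedT22q (soloInformedOpenCube 4) := by
  refine ContinuousOn.div (Continuous.continuousOn (by fun_prop))
    (Continuous.continuousOn (by fun_prop)) fun x hx => ?_
  exact (mul_pos (soloInformed_T22_pos1 hx) (soloInformed_T22_pos3 hx)).ne'

/-- Integrability of `q` (dominated by `S`). -/
theorem soloInformed_integrableOn_T22q : IntegrableOn soloInformedT22q (soloInformedOpenCube 4) := by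
  refine soloInformed_integrableOn_of_le_W (soloInformed_measurableSet_openCube 4) subset_rfl
    soloInformed_continuousOn_T22q soloInformedZ4E2 soloInformedZ4E2_lt_one 1 fun x hx => ?_
  rw [one_mul, abs_of_nonneg (soloInformedT22q_bounds hx).1]
  refine (soloInformedT22q_bounds hx).2.trans ?_
  rw [soloInformedT22_R2_integrand]; exact soloInformed_T22FS_le_W hx

end bounds

/-- `Q = [(0,1)⁴, q]`. -/
def soloInformedT22QRep : IntegralRep 4 where
  domain := soloInformedOpenCube 4
  integrand := soloInformedT22q
  isSemialgebraic_domain := isSemialgebraic_soloInformedOpenCube 4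
  isSemialgebraicFunOn_integrand :=
    soloInformed_isSemialgebraicFunOn_quot (isSemialgebraic_soloInformedOpenCube 4) (X 1 * X 0)
      ((1 - X 1 * X 0) * (1 - X 1 * X 0 * (X 2 * X 3))) _
      (fun x hx => by
        simpa using (mul_pos (soloInformed_T22_pos1 hx) (soloInformed_T22_pos3 hx)).ne')
      fun x _ => by simp [soloInformedT22q]
  integrableOn := soloInformed_integrableOn_T22q

/-- **(1b)** `[R₂] − [Q] − [P₂] ∈ relations`. -/
theorem soloInformed_t22_s_move1 :
    of soloInformedT22Datum.R2 - of soloInformedT22QRep - of soloInformedZ4P2 ∈ relations :=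
  integrandAddRel_subset_relations ⟨4, soloInformedT22Datum.R2, soloInformedT22QRep, soloInformedZ4P2,
    rfl, rfl, fun _ hx => soloInformed_T22FS_eq_q_add_p2 hx, rfl⟩

/-- **(2) along `κ`**: `[Q] − [Z(2,2)] ∈ relations`. -/
theorem soloInformed_t22_s_move2 : of soloInformedT22QRep - of soloInformedZ22 ∈ relations :=
  soloInformed_of_sub_of_mem_relations_polyMapCLM (soloInformedMonoPoly 4) soloInformedT22QRep
    soloInformedZ22 (soloInformed_injOn_kappa 4)
    (by rw [soloInformedZ22_domain]; exact soloInformed_image_kappa4.symm)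
    fun x hx => soloInformedT22q_kappa hx

/-- **The star side assembled**: `[R₂] − ([Z(2,2)] + [Z(4)]) ∈ relations`
(Kaneko–Yamamoto: `ζ⋆(2,2) = ζ(2,2) + ζ(4)`, inside the rules). -/
theorem soloInformed_t22_R2_sub :
    of soloInformedT22Datum.R2 - (of soloInformedZ22 + of soloInformedZ4) ∈ relations := by
  have h : of soloInformedT22Datum.R2 - (of soloInformedZ22 + of soloInformedZ4)
      = (of soloInformedT22Datum.R2 - of soloInformedT22QRep - of soloInformedZ4P2)
        + (of soloInformedT22QRep - of soloInformedZ22) + (of soloInformedZ4P2 - of soloInformedZ4) := by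
    abel
  rw [h]
  exact relations.add_mem (relations.add_mem soloInformed_t22_s_move1 soloInformed_t22_s_move2)
    soloInformed_s_move3

/-! ## 3. The relation `4·[Z(3,1)] = [Z(4)]` and the cyclicity of the weight-4 sector -/

/-- **THEOREM (the weight-4 finite-double-shuffle relation inside `KZ.relations`, by the telescope).**
`4·[Z(3,1)] − [Z(4)] ∈ KZ.relations`. -/
theorem soloInformed_fds4_mem_relations : 4 • of soloInformedZ31 - of soloInformedZ4 ∈ relations := by
  have h : 4 • of soloInformedZ31 - of soloInformedZ4
      = (of soloInformedT22Datum.R1 - of soloInformedT22Datum.R2)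
        - (of soloInformedT22Datum.R1 - (of soloInformedZ22 + 4 • of soloInformedZ31))
        + (of soloInformedT22Datum.R2 - (of soloInformedZ22 + of soloInformedZ4)) := by abel
  rw [h]
  exact relations.add_mem (relations.sub_mem soloInformed_t22_telescope soloInformed_t22_R1_sub)
    soloInformed_t22_R2_sub

/-- **COROLLARY (in `𝒫`).** `4 • mzvClass [3,1] = mzvClass [4]`. -/
theorem soloInformed_mzvClass_fds4 : 4 • mzvClass [3, 1] = mzvClass [4] := by
  rw [← soloInformed_toFormalPeriod_Z31, ← soloInformed_toFormalPeriod_Z4, ← map_nsmul,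
    toFormalPeriod_eq_iff]
  exact soloInformed_fds4_mem_relations

/-- The same, multiplicatively: `4 * mzvClass [3,1] = mzvClass [4]`. -/
theorem soloInformed_mzvClass_fds4' : (4 : FormalPeriodRing) * mzvClass [3, 1] = mzvClass [4] := by
  have h := soloInformed_mzvClass_fds4
  rwa [nsmul_eq_mul, Nat.cast_ofNat] at h

/-- **THEOREM (cyclicity of the weight-4 MZV sector of `𝒫`, by KZ moves alone).**
`mzvClass [4] = 4·c`, `mzvClass [2,2] = 3·c`, `mzvClass [2,1,1] = 4·c` with `c = mzvClass [3,1]`: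
every weight-4 admissible class is an integer multiple of `⟦Z(3,1)⟧` — from the telescope relations
(sum formula, `4[3,1] = [4]`) and the duality reflection. -/
theorem soloInformed_mzvClass_weight4_cyclic :
    mzvClass [4] = 4 • mzvClass [3, 1] ∧ mzvClass [2, 2] = 3 • mzvClass [3, 1] ∧
    mzvClass [2, 1, 1] = 4 • mzvClass [3, 1] := by
  have h1 := soloInformed_mzvClass_fds4
  have h2 := soloInformed_mzvClass_sumFormula4
  have h3 := soloInformed_mzvClass_duality4
  refine ⟨h1.symm, ?_, by rw [h3, h1]⟩
  have h4 : mzvClass [2, 2] = mzvClass [4] - mzvClass [3, 1] := by rw [← h2]; abel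
  rw [h4, ← h1]
  abel

end Summit.KontsevichZagierPeriods.KontsevichZagierPeriods.Theorems
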